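import Summits.ValiantsHypothesis.ValiantsHypothesis.Theorems.LacunarySymmetroidMatrixDescartesVLawStieltjes
import Summits.ValiantsHypothesis.ValiantsHypothesis.Theorems.LacunarySymmetroidMatrixDescartesStubInertiaChain

/-!
# `MatrixDescartes` (stmt-ValiantsHypothesis-18050), line `Lift` — Lemma FULL of `VLAW-PROOF.md` in the KERNEL:
# the H-form normal form, the Gram (Hadamard–Stieltjes) decomposition, and the STAR CORE LEMMA

HONEST FRAMING.  Cell `pub-symmetroid`, seat `val-sym-mdr-p2` (gen 2); helper `--supports` the crux
`Theses.LacunarySymmetroid.MatrixDescartes`, NO closure claim.  This is the finite-algebra + positivity heart of the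
kernel proof of the registered research stub `stub_vLaw` (paper proof `VLAW-PROOF.md` §2, predecessor g0; desk
R1345 asked for exactly this file) in a form general enough for the FAN LAW (companion `…FanLaw.lean`).  Nothing here
bears on `stub_twoSided`, the crux in its window, `DoorA26`/`DoorA34`, or `VP ≠ VNP`.

THIS FILE = layers (i)–(iii) below; the STAR CORE LEMMA itself (`VLawCore.core_pos`) is in the companion
`…VLawCore.lean`, which imports this one.  THE STAR CORE LEMMA.  Data: a real symmetric `J`, positive semidefinite `P` (the LONE
letter, gap `a`) and `Q l` (`l : κ`, the CROWDED side, gaps `0 < b l < a`), and the H-form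
`H(u) = J + (u^a)⁻¹ • P + ∑ l, u^(b l) • Q l` (`= t^{-e} ·` the pencil, `u = t` for a lone LOWER letter, `u = t⁻¹` for a
lone UPPER letter).  If `v j` are kernel vectors of `H(u j)` at pairwise distinct nodes `u j > 0`, `s > 0` is not a node,
every node's Rayleigh slope points towards `s` — `0 ≤ (s − u j)·σ j`, `σ j = −a (u j^a)⁻¹ v_jᵀPv_j + ∑ l, b l·(u j)^(b l) v_jᵀQ_l v_j`
— and no `v j` is killed by all of `J, P, Q l`, THEN the quadratic form of `H(s)` is STRICTLY positive at every nonzero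
combination `∑ j, c j • v j`.  (One-sided instances: all ascending nodes left of `s`; all descending nodes right of `s`.)

CONTENTS: (i) finite algebra — bilinear expansion, H-form kernel relations, the `(q−p)·M_ij` elimination identity and
the diagonal identity (`quadForm_sum_smul`, `kernel_relation`, `offdiag_identity`, `diag_identity`); (ii) vanishing
lemmas — partial fractions `(w_i+σ)⁻¹` are linearly independent (`eq_zero_of_sum_div_eq_zero`, vector form
`eq_zero_of_sum_inv_smul_eq_zero`) and a continuous nonnegative function with zero integral on `(0,∞)` vanishes
(`eq_zero_of_integral_eq_zero`); (iii) the three Stieltjes integrals of one Gram entry (`offdiag_integral`,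
`diag_integral`) and the sum/integral interchange (`quadForm_y`, `integral_quadForm`).
PROOF OF THE CORE LEMMA (= VLAW-PROOF §2, with the Stieltjes function made rpow-free by `…VLawStieltjes.lean`).  With `w_j = (u_j^a)⁻¹`,
`t = (s^a)⁻¹`, `r_w(ρ) = (w + ρ^a)⁻¹`: the kernel relations eliminate `Ĵ` and `P̂` (`(q−p)·M_ij` identity,
`M_ij = v_iᵀH(s)v_j`), the identities `u^b·C = ∫ρ^n r_{w_u}`, `(b/a)u^{a+b}·C = ∫ρ^n r_{w_u}^2` and the partial fractions
`(q−p)(t−p)(t−q) r_p r_q r_t = (t−q) r_p − (t−p) r_q + (q−p) r_t`, `(t−p)^2 r_p^2 r_t = r_t − r_p + (t−p) r_p^2` give the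
GRAM DECOMPOSITION `∑_{ij} c_i c_j M_ij = ∑_l C_l⁻¹ ∫_{ρ>0} ρ^{n_l} r_t(ρ)·(y_ρᵀ Q_l y_ρ) dρ + ∑_i c_i^2·slack_i`,
`y_ρ = ∑_i c_i (t − w_i) r_{w_i}(ρ) • v_i`, `slack_i = (t − w_i)(P̂_ii − ∑_l (b_l/a) u_i^{a+b_l} Q̂^l_ii) ≥ 0` by STAR;
strictness: vanishing integrals force `Q_l y_ρ = 0` for all `ρ > 0`, partial fractions (`eq_zero_of_sum_div_eq_zero`)
force `Q_l v_i = 0` on the support of `c`, the slack forces `P v_i = 0`, the kernel relation `J v_i = 0` —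
contradicting nondegeneracy.  [folklore] Löwner/Stieltjes kernel positivity; elementary given the analysis layer.
-/

-- layout Summits/ValiantsHypothesis/ValiantsHypothesis forces the duplicated namespace component
set_option linter.dupNamespace false

namespace Summit.ValiantsHypothesis.ValiantsHypothesis.Theorems.LacunarySymmetroidMatrixDescartes

open MeasureTheory Set Filter Topology Matrix Finset
open scoped BigOperators

namespace VLawNormalForm

/-! ## Finite algebra: bilinear expansion and kernel relations -/

section Algebra

variable {ι : Type*} [Fintype ι]

/-- Bilinear expansion of the quadratic form at a finite combination. [folklore] -/
theorem quadForm_sum_smul (A : Matrix ι ι ℝ) {k : ℕ} (c : Fin k → ℝ) (v : Fin k → ι → ℝ) :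
    (∑ i, c i • v i) ⬝ᵥ (A *ᵥ ∑ j, c j • v j) = ∑ i, ∑ j, c i * c j * (v i ⬝ᵥ (A *ᵥ v j)) := by
  simp only [mulVec_sum, mulVec_smul, dotProduct_sum, sum_dotProduct, dotProduct_smul, smul_dotProduct,
    smul_eq_mul, Finset.mul_sum]
  rw [Finset.sum_comm]
  refine Finset.sum_congr rfl fun i _ => Finset.sum_congr rfl fun j _ => ?_
  ring

/-- The quadratic form of the H-form matrix `J + w • P + ∑ l, g l • Q l` between two vectors, expanded. [folklore] -/
theorem form_hform {κ : Type*} [Fintype κ] (J P : Matrix ι ι ℝ) (Q : κ → Matrix ι ι ℝ) (w : ℝ)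
    (g : κ → ℝ) (x y : ι → ℝ) :
    x ⬝ᵥ ((J + w • P + ∑ l, g l • Q l) *ᵥ y)
      = x ⬝ᵥ (J *ᵥ y) + w * (x ⬝ᵥ (P *ᵥ y)) + ∑ l, g l * (x ⬝ᵥ (Q l *ᵥ y)) := by
  simp only [add_mulVec, smul_mulVec, Matrix.sum_mulVec, dotProduct_add, dotProduct_smul, dotProduct_sum,
    smul_eq_mul]

/-- **Kernel relation.**  If `(J + w • P + ∑ l, g l • Q l) *ᵥ v = 0` then for every `x`,
`x ⬝ᵥ J v + w · x ⬝ᵥ P v + ∑ l, g l · x ⬝ᵥ Q_l v = 0`. [folklore] -/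
theorem kernel_relation {κ : Type*} [Fintype κ] (J P : Matrix ι ι ℝ) (Q : κ → Matrix ι ι ℝ) (w : ℝ)
    (g : κ → ℝ) {v : ι → ℝ} (hv : (J + w • P + ∑ l, g l • Q l) *ᵥ v = 0) (x : ι → ℝ) :
    x ⬝ᵥ (J *ᵥ v) + w * (x ⬝ᵥ (P *ᵥ v)) + ∑ l, g l * (x ⬝ᵥ (Q l *ᵥ v)) = 0 := by
  rw [← form_hform, hv, dotProduct_zero]

/-- **The `(q − p)·M_ij` identity** (elimination of `Ĵ` and `P̂` between two distinct nodes).  From the kernel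
relations at node `i` (weights `p`, `gp`) and node `j` (weights `q`, `gq`), symmetry of all letters, for the
target weights `(t, gt)`:
`(q − p) · v_iᵀ H_t v_j = ∑ l, Q̂^l_ij · ((t − q)·gp l − (t − p)·gq l + (q − p)·gt l)`. [folklore] -/
theorem offdiag_identity {κ : Type*} [Fintype κ] {J P : Matrix ι ι ℝ} {Q : κ → Matrix ι ι ℝ}
    (hJ : J.IsSymm) (hP : P.IsSymm) (hQ : ∀ l, (Q l).IsSymm) (p q t : ℝ) (gp gq gt : κ → ℝ)
    {vi vj : ι → ℝ} (hi : (J + p • P + ∑ l, gp l • Q l) *ᵥ vi = 0)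
    (hj : (J + q • P + ∑ l, gq l • Q l) *ᵥ vj = 0) :
    (q - p) * (vi ⬝ᵥ ((J + t • P + ∑ l, gt l • Q l) *ᵥ vj))
      = ∑ l, (vi ⬝ᵥ (Q l *ᵥ vj)) * ((t - q) * gp l - (t - p) * gq l + (q - p) * gt l) := by
  have h1 := kernel_relation J P Q p gp hi vj
  have h2 := kernel_relation J P Q q gq hj vi
  rw [StubInertiaChain.dotProduct_mulVec_comm hJ vj vi, StubInertiaChain.dotProduct_mulVec_comm hP vj vi] at h1
  simp_rw [StubInertiaChain.dotProduct_mulVec_comm (hQ _) vj vi] at h1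
  rw [form_hform]
  -- `h1 : Ĵ + p P̂ + ∑ gp Q̂ = 0`, `h2 : Ĵ + q P̂ + ∑ gq Q̂ = 0` (all in the `vi ⬝ _ vj` orientation)
  have eJ : vi ⬝ᵥ (J *ᵥ vj) = -(p * (vi ⬝ᵥ (P *ᵥ vj))) - ∑ l, gp l * (vi ⬝ᵥ (Q l *ᵥ vj)) := by linarith
  have eP : (q - p) * (vi ⬝ᵥ (P *ᵥ vj))
      = ∑ l, gp l * (vi ⬝ᵥ (Q l *ᵥ vj)) - ∑ l, gq l * (vi ⬝ᵥ (Q l *ᵥ vj)) := by linarith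
  have : (q - p) * (vi ⬝ᵥ (J *ᵥ vj) + t * (vi ⬝ᵥ (P *ᵥ vj)) + ∑ l, gt l * (vi ⬝ᵥ (Q l *ᵥ vj)))
      = (t - p) * ((q - p) * (vi ⬝ᵥ (P *ᵥ vj))) - (q - p) * ∑ l, gp l * (vi ⬝ᵥ (Q l *ᵥ vj))
        + (q - p) * ∑ l, gt l * (vi ⬝ᵥ (Q l *ᵥ vj)) := by
    rw [eJ]; ring
  rw [this, eP, ← Finset.sum_sub_distrib, Finset.mul_sum, Finset.mul_sum, Finset.mul_sum, ← Finset.sum_sub_distrib,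
    ← Finset.sum_add_distrib]
  refine Finset.sum_congr rfl fun l _ => ?_
  ring

/-- **Diagonal identity.**  From the kernel relation at node `i` (weights `p`, `gp`):
`v_iᵀ H_t v_i = (t − p) P̂_ii + ∑ l, (gt l − gp l) Q̂^l_ii`. [folklore] -/
theorem diag_identity {κ : Type*} [Fintype κ] (J P : Matrix ι ι ℝ) (Q : κ → Matrix ι ι ℝ) (p t : ℝ)
    (gp gt : κ → ℝ) {vi : ι → ℝ} (hi : (J + p • P + ∑ l, gp l • Q l) *ᵥ vi = 0) :
    vi ⬝ᵥ ((J + t • P + ∑ l, gt l • Q l) *ᵥ vi)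
      = (t - p) * (vi ⬝ᵥ (P *ᵥ vi)) + ∑ l, (gt l - gp l) * (vi ⬝ᵥ (Q l *ᵥ vi)) := by
  have h1 := kernel_relation J P Q p gp hi vi
  rw [form_hform]
  have eJ : vi ⬝ᵥ (J *ᵥ vi) = -(p * (vi ⬝ᵥ (P *ᵥ vi))) - ∑ l, gp l * (vi ⬝ᵥ (Q l *ᵥ vi)) := by linarith
  rw [eJ]
  simp only [sub_mul, Finset.sum_sub_distrib]
  ring

end Algebra


/-! ## Vanishing lemmas: partial fractions are independent; a continuous nonnegative integrand with zero
integral vanishes -/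

section Vanishing

/-- **Partial fractions are linearly independent.**  If `∑ i, β i · (w i + σ)⁻¹ = 0` for all `σ` in an infinite
set on which no `w i + σ` vanishes, and the `w i` are pairwise distinct, then `β = 0` (clear denominators: the
polynomial `∑ i, β i ∏_{j ≠ i} (w j + X)` has infinitely many roots, and its value at `−w i` is
`β i ∏_{j≠i} (w j − w i)`). [folklore] -/
theorem eq_zero_of_sum_div_eq_zero {k : ℕ} (w : Fin k → ℝ) (hinj : Function.Injective w) (β : Fin k → ℝ)
    (S : Set ℝ) (hS : S.Infinite) (hSw : ∀ σ ∈ S, ∀ i, w i + σ ≠ 0)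
    (h : ∀ σ ∈ S, ∑ i, β i * (w i + σ)⁻¹ = 0) : β = 0 := by
  classical
  set poly : Polynomial ℝ :=
    ∑ i, Polynomial.C (β i) * ∏ j ∈ Finset.univ.erase i, (Polynomial.C (w j) + Polynomial.X) with hpoly
  have heval : ∀ σ : ℝ, poly.eval σ = ∑ i, β i * ∏ j ∈ Finset.univ.erase i, (w j + σ) := by
    intro σ
    simp only [hpoly, Polynomial.eval_finsetSum, Polynomial.eval_mul, Polynomial.eval_C, Polynomial.eval_prod,
      Polynomial.eval_add, Polynomial.eval_X]
  -- every `σ ∈ S` is a root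
  have hroot : ∀ σ ∈ S, poly.IsRoot σ := by
    intro σ hσ
    rw [Polynomial.IsRoot.def, heval]
    have hprod : ∀ i, ∏ j ∈ Finset.univ.erase i, (w j + σ) = (∏ j, (w j + σ)) * (w i + σ)⁻¹ := by
      intro i
      rw [eq_mul_inv_iff_mul_eq₀ (hSw σ hσ i), mul_comm]
      exact Finset.mul_prod_erase Finset.univ (fun j => w j + σ) (Finset.mem_univ i)
    simp_rw [hprod, ← mul_assoc, mul_comm (β _) (∏ j, (w j + σ)), mul_assoc, ← Finset.mul_sum, h σ hσ,
      mul_zero]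
  have hzero : poly = 0 :=
    Polynomial.eq_zero_of_infinite_isRoot poly (hS.mono fun σ hσ => hroot σ hσ)
  funext i
  have hi := congrArg (Polynomial.eval (-w i)) hzero
  rw [Polynomial.eval_zero, heval, Finset.sum_eq_single i] at hi
  · have hne : ∏ j ∈ Finset.univ.erase i, (w j + -w i) ≠ 0 := by
      rw [Finset.prod_ne_zero_iff]
      intro j hj
      rw [← sub_eq_add_neg, sub_ne_zero]
      exact fun hji => (Finset.ne_of_mem_erase hj) (hinj hji)
    exact (mul_eq_zero.1 hi).resolve_right hne
  · intro i' _ hi'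
    rw [mul_eq_zero]
    right
    exact Finset.prod_eq_zero (Finset.mem_erase.2 ⟨fun h => hi' h.symm, Finset.mem_univ i⟩) (by ring)
  · simp

/-- Vector version over the Stieltjes abscissae `σ = ρ^a`, `ρ > 0`: if `∑ i, (w i + ρ^a)⁻¹ • β i = 0` for every
`ρ > 0` (pairwise distinct `w i > 0`, `0 < a`), then every `β i = 0`. [folklore] -/
theorem eq_zero_of_sum_inv_smul_eq_zero {ι : Type*} {k a : ℕ} (ha : 0 < a) (w : Fin k → ℝ)
    (hw : ∀ i, 0 < w i) (hinj : Function.Injective w) (β : Fin k → ι → ℝ)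
    (h : ∀ ρ : ℝ, 0 < ρ → ∑ i, (w i + ρ ^ a)⁻¹ • β i = 0) : ∀ i, β i = 0 := by
  classical
  -- the set of abscissae `ρ^a`, `ρ > 0`, is infinite (the power map is injective on `(0, ∞)`)
  have hinjpow : Set.InjOn (fun ρ : ℝ => ρ ^ a) (Ioi 0) := by
    intro x hx y hy hxy
    exact (pow_left_inj₀ hx.out.le hy.out.le ha.ne').1 hxy
  have hS : (Set.image (fun ρ : ℝ => ρ ^ a) (Ioi 0)).Infinite :=
    (Set.Ioi_infinite (0:ℝ)).image hinjpow
  intro i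
  funext x
  have hsc := eq_zero_of_sum_div_eq_zero w hinj (fun i => β i x) (Set.image (fun ρ : ℝ => ρ ^ a) (Ioi 0)) hS
    (fun σ hσ i => by
      obtain ⟨ρ, hρ, rfl⟩ := hσ
      exact (VLawStieltjes.den_pos (hw i) a hρ.out.le).ne')
    (fun σ hσ => by
      obtain ⟨ρ, hρ, rfl⟩ := hσ
      have := congrFun (h ρ hρ.out) x
      simpa [Finset.sum_apply, Pi.smul_apply, smul_eq_mul, mul_comm] using this)
  exact congrFun hsc i

/-- A function that is continuous and nonnegative on `(0, ∞)`, integrable there with integral zero, vanishes on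
`(0, ∞)`. [folklore] -/
theorem eq_zero_of_integral_eq_zero {f : ℝ → ℝ} (hcont : ContinuousOn f (Ioi 0)) (hnn : ∀ ρ, 0 < ρ → 0 ≤ f ρ)
    (hint : IntegrableOn f (Ioi 0)) (h0 : ∫ ρ in Ioi (0:ℝ), f ρ = 0) : ∀ ρ, 0 < ρ → f ρ = 0 := by
  by_contra hne
  push Not at hne
  obtain ⟨ρ₀, hρ₀, hf₀⟩ := hne
  have hpos₀ : 0 < f ρ₀ := lt_of_le_of_ne (hnn ρ₀ hρ₀) (Ne.symm hf₀)
  have hU : IsOpen (Ioi (0:ℝ) ∩ f ⁻¹' Ioi 0) := hcont.isOpen_inter_preimage isOpen_Ioi isOpen_Ioi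
  have hUpos : 0 < volume (Ioi (0:ℝ) ∩ f ⁻¹' Ioi 0) := hU.measure_pos volume ⟨ρ₀, hρ₀, hpos₀⟩
  have hsub : Ioi (0:ℝ) ∩ f ⁻¹' Ioi 0 ⊆ Function.support f ∩ Ioi 0 := by
    rintro ρ ⟨hρ, hfρ⟩
    exact ⟨(show 0 < f ρ from hfρ).ne', hρ⟩
  have hint_pos : 0 < ∫ ρ in Ioi (0:ℝ), f ρ := by
    rw [setIntegral_pos_iff_support_of_nonneg_ae (ae_restrict_of_forall_mem measurableSet_Ioi
      fun ρ hρ => hnn ρ hρ) hint]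
    exact lt_of_lt_of_le hUpos (measure_mono hsub)
  rw [h0] at hint_pos
  exact lt_irrefl _ hint_pos

end Vanishing

/-! ## The three Stieltjes integrals behind one entry of the Gram decomposition -/

section Integrals

/-- **Off-diagonal kernel integral.**  For positive `p, q, t` and `n + 2 ≤ a`, with
`I_w = ∫_{ρ>0} ρ^n/(w+ρ^a)` given as `g_w · C`:
`(q−p)(t−p)(t−q) · ∫ ρ^n r_p r_q r_t = C · ((t−q) g_p − (t−p) g_q + (q−p) g_t)` (partial fractions
`(q−p)(t−p)(t−q) r_p r_q r_t = (t−q) r_p − (t−p) r_q + (q−p) r_t`, `r_w = (w+ρ^a)⁻¹`). [folklore] -/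
theorem offdiag_integral {n a : ℕ} (hna : n + 2 ≤ a) {p q t : ℝ} (hp : 0 < p) (hq : 0 < q) (ht : 0 < t)
    {gp gq gt C : ℝ} (ep : ∫ ρ in Ioi (0:ℝ), ρ ^ n / (p + ρ ^ a) = gp * C)
    (eq : ∫ ρ in Ioi (0:ℝ), ρ ^ n / (q + ρ ^ a) = gq * C) (et : ∫ ρ in Ioi (0:ℝ), ρ ^ n / (t + ρ ^ a) = gt * C) :
    (q - p) * (t - p) * (t - q) * ∫ ρ in Ioi (0:ℝ), ρ ^ n / (p + ρ ^ a) * ((q + ρ ^ a)⁻¹ * (t + ρ ^ a)⁻¹)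
      = C * ((t - q) * gp - (t - p) * gq + (q - p) * gt) := by
  have hIp := VLawStieltjes.integrableOn_stieltjes hna hp
  have hIq := VLawStieltjes.integrableOn_stieltjes hna hq
  have hIt := VLawStieltjes.integrableOn_stieltjes hna ht
  have hcongr : EqOn (fun ρ : ℝ => (q - p) * (t - p) * (t - q) * (ρ ^ n / (p + ρ ^ a) * ((q + ρ ^ a)⁻¹ * (t + ρ ^ a)⁻¹)))
      (fun ρ => (t - q) * (ρ ^ n / (p + ρ ^ a)) - (t - p) * (ρ ^ n / (q + ρ ^ a)) + (q - p) * (ρ ^ n / (t + ρ ^ a)))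
      (Ioi 0) := by
    intro ρ hρ
    have h1 : p + ρ ^ a ≠ 0 := (VLawStieltjes.den_pos hp a hρ.out.le).ne'
    have h2 : q + ρ ^ a ≠ 0 := (VLawStieltjes.den_pos hq a hρ.out.le).ne'
    have h3 : t + ρ ^ a ≠ 0 := (VLawStieltjes.den_pos ht a hρ.out.le).ne'
    simp only
    field_simp
    ring
  rw [← integral_const_mul, setIntegral_congr_fun measurableSet_Ioi hcongr,
    integral_add ((hIp.const_mul _).sub' (hIq.const_mul _)) (hIt.const_mul _),
    integral_sub (hIp.const_mul _) (hIq.const_mul _), integral_const_mul, integral_const_mul, integral_const_mul,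
    ep, eq, et]
  ring

/-- **Diagonal kernel integral.**  For positive `p, t` and `n + 2 ≤ a`, with `I_w = g_w · C` as above and
`∫_{ρ>0} ρ^n/(p+ρ^a)^2 = h_p · C`:
`(t−p)^2 · ∫ ρ^n r_p^2 r_t = C · (g_t − g_p + (t−p) h_p)` (from `(t−p)^2 r_p^2 r_t = r_t − r_p + (t−p) r_p^2`).
[folklore] -/
theorem diag_integral {n a : ℕ} (hna : n + 2 ≤ a) {p t : ℝ} (hp : 0 < p) (ht : 0 < t) {gp gt hp2 C : ℝ}
    (ep : ∫ ρ in Ioi (0:ℝ), ρ ^ n / (p + ρ ^ a) = gp * C) (et : ∫ ρ in Ioi (0:ℝ), ρ ^ n / (t + ρ ^ a) = gt * C)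
    (ep2 : ∫ ρ in Ioi (0:ℝ), ρ ^ n / (p + ρ ^ a) ^ 2 = hp2 * C) :
    (t - p) ^ 2 * ∫ ρ in Ioi (0:ℝ), ρ ^ n / (p + ρ ^ a) * ((p + ρ ^ a)⁻¹ * (t + ρ ^ a)⁻¹)
      = C * (gt - gp + (t - p) * hp2) := by
  have hIp := VLawStieltjes.integrableOn_stieltjes hna hp
  have hIt := VLawStieltjes.integrableOn_stieltjes hna ht
  have hIp2 := VLawStieltjes.integrableOn_stieltjes_sq hna hp
  have hcongr : EqOn (fun ρ : ℝ => (t - p) ^ 2 * (ρ ^ n / (p + ρ ^ a) * ((p + ρ ^ a)⁻¹ * (t + ρ ^ a)⁻¹)))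
      (fun ρ => ρ ^ n / (t + ρ ^ a) - ρ ^ n / (p + ρ ^ a) + (t - p) * (ρ ^ n / (p + ρ ^ a) ^ 2)) (Ioi 0) := by
    intro ρ hρ
    have h1 : p + ρ ^ a ≠ 0 := (VLawStieltjes.den_pos hp a hρ.out.le).ne'
    have h3 : t + ρ ^ a ≠ 0 := (VLawStieltjes.den_pos ht a hρ.out.le).ne'
    simp only
    field_simp
    ring
  rw [← integral_const_mul, setIntegral_congr_fun measurableSet_Ioi hcongr,
    integral_add (hIt.sub' hIp) (hIp2.const_mul _), integral_sub hIt hIp, integral_const_mul, ep, et, ep2]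
  ring

/-- Pointwise: the kernel integrand of the Gram decomposition is the quadratic form of `Q` at
`y_ρ = ∑ i, (e i · r_{w i}(ρ)) • v i`, weighted by `ρ^n r_t(ρ)`. [folklore] -/
theorem quadForm_y {ι : Type*} [Fintype ι] {k : ℕ} (n a : ℕ) (w : Fin k → ℝ) (t : ℝ) (Qm : Matrix ι ι ℝ)
    (v : Fin k → ι → ℝ) (e : Fin k → ℝ) (ρ : ℝ) :
    ∑ i, ∑ j, e i * e j * (v i ⬝ᵥ (Qm *ᵥ v j)) * (ρ ^ n / (w i + ρ ^ a) * ((w j + ρ ^ a)⁻¹ * (t + ρ ^ a)⁻¹))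
      = ρ ^ n * (t + ρ ^ a)⁻¹ *
        ((∑ i, (e i * (w i + ρ ^ a)⁻¹) • v i) ⬝ᵥ (Qm *ᵥ ∑ j, (e j * (w j + ρ ^ a)⁻¹) • v j)) := by
  rw [quadForm_sum_smul Qm (fun i => e i * (w i + ρ ^ a)⁻¹) v, Finset.mul_sum]
  refine Finset.sum_congr rfl fun i _ => ?_
  rw [Finset.mul_sum]
  refine Finset.sum_congr rfl fun j _ => ?_
  rw [div_eq_mul_inv]
  ring

/-- Every summand of the kernel integrand is integrable on `(0, ∞)`. [folklore] -/
theorem integrableOn_kernel_term {n a : ℕ} (hna : n + 2 ≤ a) {wi wj t : ℝ} (hwi : 0 < wi) (hwj : 0 < wj)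
    (ht : 0 < t) (κ0 : ℝ) :
    IntegrableOn (fun ρ : ℝ => κ0 * (ρ ^ n / (wi + ρ ^ a) * ((wj + ρ ^ a)⁻¹ * (t + ρ ^ a)⁻¹))) (Ioi 0) := by
  refine Integrable.const_mul ?_ κ0
  refine VLawStieltjes.integrableOn_stieltjes_mul hna hwi ?_ (B := wj⁻¹ * t⁻¹) ?_
  · exact ((VLawStieltjes.continuousOn_inv_den a hwj).mono Ioi_subset_Ici_self).mul
      ((VLawStieltjes.continuousOn_inv_den a ht).mono Ioi_subset_Ici_self)
  · intro ρ hρ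
    have h1 := VLawStieltjes.inv_den_le (a := a) hwj hρ.le
    have h2 := VLawStieltjes.inv_den_le (a := a) ht hρ.le
    rw [abs_of_nonneg (mul_nonneg h1.1 h2.1)]
    exact mul_le_mul h1.2 h2.2 h2.1 (le_of_lt (inv_pos.2 hwj))

/-- **Interchange** of the finite double sum and the integral in the Gram decomposition. [folklore] -/
theorem integral_quadForm {ι : Type*} [Fintype ι] {k n a : ℕ} (hna : n + 2 ≤ a) (w : Fin k → ℝ)
    (hw : ∀ i, 0 < w i) {t : ℝ} (ht : 0 < t) (Qm : Matrix ι ι ℝ) (v : Fin k → ι → ℝ) (e : Fin k → ℝ) :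
    ∫ ρ in Ioi (0:ℝ), ∑ i, ∑ j, e i * e j * (v i ⬝ᵥ (Qm *ᵥ v j))
        * (ρ ^ n / (w i + ρ ^ a) * ((w j + ρ ^ a)⁻¹ * (t + ρ ^ a)⁻¹))
      = ∑ i, ∑ j, e i * e j * (v i ⬝ᵥ (Qm *ᵥ v j))
        * ∫ ρ in Ioi (0:ℝ), ρ ^ n / (w i + ρ ^ a) * ((w j + ρ ^ a)⁻¹ * (t + ρ ^ a)⁻¹) := by
  rw [integral_finsetSum _ fun i _ => integrable_finsetSum _ fun j _ =>
    integrableOn_kernel_term hna (hw i) (hw j) ht _]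
  refine Finset.sum_congr rfl fun i _ => ?_
  rw [integral_finsetSum _ fun j _ => integrableOn_kernel_term hna (hw i) (hw j) ht _]
  refine Finset.sum_congr rfl fun j _ => ?_
  exact integral_const_mul _ _

end Integrals

end VLawNormalForm

end Summit.ValiantsHypothesis.ValiantsHypothesis.Theorems.LacunarySymmetroidMatrixDescartes
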